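import Summits.AtomisticToContinuum.HydrodynamicLimit.Theses.AntiMazurCoboundaries
import Summits.AtomisticToContinuum.HydrodynamicLimit.Theorems.AntiMazurCoboundariesKineticWindowGronwallBoostRegular
import Literature.Analysis.FluidPDE.HardSphereFlowRegular
import HarnessLib

/-!
# Frame covariance of the crux's antecedent, I: statements, moving test functions, the canonical-flow dictionary

Crux `Summit.AtomisticToContinuum.HydrodynamicLimit.Theses.AntiMazurCoboundaries.KineticWindowGronwall`
(stmt-AtomisticToContinuum-9282) `= (KineticFluxLdDecay → RelEntropyVanishing)`, line `dlr-block-transfer` v6; file 1 of 2 of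
the registered helper stub `stub_kineticFrameUniv : KineticFluxLdDecayIffUniv` (file 2:
`…KineticWindowGronwallFrameUniv.lean`), carrying the registered helper stub `stub_windowFreezing : WindowFreezing` (the
junk-free comparison of the moving and the frozen test function along an orbit measurable in time). Lead prover,
continuation c1.

THE STATEMENT. In the crux's antecedent `A = KineticFluxLdDecay` the threshold `σ₀` is chosen after the frame
`(a, θ, u₀)` (activity, temperature, drift of the homogeneous local Gibbs law `G_N(a, u₀, θ)`) and the amplitude `κ` after
`σ`. We prove `A ↔ KineticFluxLdDecayUniv`, where the universal form has `∃ σ₀` FIRST and, for each `σ < σ₀`, ONE amplitude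
`κ(σ)` serving every frame: the dependence of the constants on `(a, θ, u₀)` is fictitious. Consequently the crux is
equivalent to `KineticFluxLdDecayUniv → RelEntropyVanishing`.

THE PROOF is exact covariance of deterministic hard-sphere dynamics on `𝕋³`:
* activity: at fixed particle number a constant activity cancels from the canonical density
  (`KineticWindowGronwallNegative.localGibbsLaw_const_activity`);
* temperature: the thermal scaling `v ↦ v/√θ`, `t ↦ t√θ` maps hard-sphere flows to hard-sphere flows
  (`KineticWindowGronwallThermalScaling.thermalScale`) and `G_N(1, 0, θ)` to `G_N(1, 0, 1)`, windows `τ` to `√θ τ`;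
* drift: every flow is the canonical (regularised Alexander) flow a.e. at all forward times
  (`KineticWindowGronwallBoost.ae_forall_flow_eq_regFlow`), the velocity translation `v ↦ v + u₀` carries `G_N(1, 0, θ)` to
  `G_N(1, u₀, θ)` (rung-0 product structure), and conjugating the canonical flow by the Galilean boost
  `boostAt u₀ t : (x, v) ↦ (x + t u₀, v + u₀)` gives an honest hard-sphere flow (`boostReg`); in the boosted frame the test
  function becomes the moving one `φ(x + s u₀)`, `0 ≤ s ≤ h = τ(N+1)^{-1/3} → 0`, and since `φ` is uniformly continuous on
  the compact torus and `|g| ≤ κ`, freezing it costs a factor `exp(o(1) κ (N+1))`, absorbed in `exp(δ(N+1))`.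
-/

noncomputable section

open MeasureTheory Filter Set Topology Function
open scoped ENNReal
open Literature.MathematicalPhysics.KineticTheory Literature.Analysis.FluidPDE
open Summit.AtomisticToContinuum.HydrodynamicLimit.Theses.AntiMazurCoboundaries
open Summit.AtomisticToContinuum.HydrodynamicLimit.Theorems.KineticWindowGronwallBoost

namespace Summit.AtomisticToContinuum.HydrodynamicLimit.Theorems.KineticWindowGronwallFrame

/-! ## §1 Statements -/

/-- Abbreviation: the type of hard-sphere flows of `N + 1` spheres of reduced diameter `σ` on `𝕋³`. -/
abbrev TFlow (σ : ℝ) (N : ℕ) : Type :=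
  HardSphereFlow (Torus.geometry (Fin 3)) (hsDiameter σ N) (N + 1)

/-- **The kinetic-window exponential moment of the crux's antecedent** (its left-hand side, as a function of all
parameters): `∫⁻ exp(h⁻¹ ∫₀ʰ Σᵢ φ(xᵢ(s)) g((vᵢ(s) − u₀)/√θ) ds) dG_N(a, u₀, θ)`, `h = τ (N+1)^{-1/3}`. -/
def windowMoment (σ a θ : ℝ) (u₀ : V3) (N : ℕ) (Φ : TFlow σ N) (φ : T3 → ℝ) (g : V3 → ℝ) (τ : ℝ) : ℝ≥0∞ :=
  ∫⁻ z, ENNReal.ofReal (Real.exp ((τ * ((N + 1 : ℕ) : ℝ) ^ (-(1 / 3 : ℝ)))⁻¹ *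
      ∫ s in (0 : ℝ)..(τ * ((N + 1 : ℕ) : ℝ) ^ (-(1 / 3 : ℝ))),
        ∑ i, φ (Φ.flow s z i).1 * g ((Real.sqrt θ)⁻¹ • ((Φ.flow s z i).2 - u₀))))
    ∂(localGibbsLaw σ (fun _ => a) (fun _ => u₀) (fun _ => θ) N Φ)

/-- The orthogonality clause of the antecedent: `g ⊥ span{1, v, ‖v‖²}` in `L²(stdGaussian)`. -/
def OrthogonalToCollisionInvariants (g : V3 → ℝ) : Prop :=
  ∀ (c₀ c₂ : ℝ) (b : V3), ∫ v, g v * (c₀ + inner ℝ b v + c₂ * ‖v‖ ^ 2) ∂(ProbabilityTheory.stdGaussian V3) = 0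

/-- **The body of the antecedent at a frame `(a, θ, u₀)`, a parameter `σ` and an amplitude `κ`** (the conjunction after
`σ < σ₀` in `KineticFluxLdDecay`, with `κ` pulled out as an argument). -/
def FrameBody (σ a θ : ℝ) (u₀ : V3) (κ : ℝ) : Prop :=
  ∀ (φ : T3 → ℝ) (g : V3 → ℝ), Continuous φ → Continuous g → (∀ x, |φ x| ≤ 1) → (∀ v, |g v| ≤ κ) →
    OrthogonalToCollisionInvariants g →
    ∀ δ : ℝ, 0 < δ → ∃ τ : ℝ, 0 < τ ∧ ∃ N₀ : ℕ, ∀ N : ℕ, N₀ ≤ N → ∀ Φ : TFlow σ N,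
      windowMoment σ a θ u₀ N Φ φ g τ ≤ ENNReal.ofReal (Real.exp (δ * (N + 1)))

/-- The probability clause of the antecedent at a frame. -/
def ProbClause (σ a θ : ℝ) (u₀ : V3) : Prop :=
  ∀ (N : ℕ) (Φ : TFlow σ N), IsProbabilityMeasure (localGibbsLaw σ (fun _ => a) (fun _ => u₀) (fun _ => θ) N Φ)

/-- **`KineticFluxLdDecay`, UNIVERSAL FORM**: one threshold `σ₀` and, for each `σ < σ₀`, one amplitude `κ` serving every
frame `(a, θ, u₀)` (activity, temperature, drift); all else verbatim. -/
def KineticFluxLdDecayUniv : Prop :=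
  ∃ σ₀ : ℝ, 0 < σ₀ ∧ ∀ σ : ℝ, 0 < σ → σ < σ₀ → ∃ κ : ℝ, 0 < κ ∧
    ∀ (a θ : ℝ) (u₀ : V3), 0 < a → 0 < θ → ProbClause σ a θ u₀ ∧ FrameBody σ a θ u₀ κ

/-- **THE REGISTERED STATEMENT** (`stub_kineticFrameUniv`): the crux's antecedent is equivalent to its universal form. -/
def KineticFluxLdDecayIffUniv : Prop :=
  KineticFluxLdDecay ↔ KineticFluxLdDecayUniv

/-- `KineticFluxLdDecay` unfolds to the frame-wise form written with `ProbClause` / `FrameBody` (definitional). -/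
theorem kineticFluxLdDecay_iff_frameBody :
    KineticFluxLdDecay ↔ ∀ (a θ : ℝ) (u₀ : V3), 0 < a → 0 < θ → ∃ σ₀ : ℝ, 0 < σ₀ ∧ ∀ σ : ℝ, 0 < σ → σ < σ₀ →
      ProbClause σ a θ u₀ ∧ ∃ κ : ℝ, 0 < κ ∧ FrameBody σ a θ u₀ κ :=
  Iff.rfl

/-! ## §2 Moving test functions on the torus -/

/-- **Uniform smallness of a Galilean displacement of a continuous test function on `𝕋³`**: for `φ` continuous,
`u ∈ ℝ³` and `η > 0` there is `s₀ > 0` with `|φ(x + proj(s u)) − φ(x)| ≤ η` for all `|s| ≤ s₀` and all `x` (uniform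
continuity on the compact torus; `proj` is continuous with `proj 0 = 0`). [folklore] -/
theorem exists_displacement_small (φ : T3 → ℝ) (hφ : Continuous φ) (u : V3) {η : ℝ} (hη : 0 < η) :
    ∃ s₀ : ℝ, 0 < s₀ ∧ ∀ s : ℝ, |s| ≤ s₀ → ∀ x : T3,
      |φ (x + Literature.Analysis.FunctionSpaces.Torus.proj (s • u)) - φ x| ≤ η := by
  have huc : UniformContinuous φ := CompactSpace.uniformContinuous_of_continuous hφ
  obtain ⟨ρ, hρ, H⟩ := Metric.uniformContinuous_iff.1 huc η hη
  have hc : Continuous fun s : ℝ => Literature.Analysis.FunctionSpaces.Torus.proj (s • u) :=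
    Literature.Analysis.FunctionSpaces.Torus.continuous_proj.comp (continuous_id.smul continuous_const)
  obtain ⟨s₁, hs₁, Hs⟩ := Metric.continuous_iff.1 hc 0 ρ hρ
  refine ⟨s₁ / 2, half_pos hs₁, fun s hs x => ?_⟩
  have hds : dist s 0 < s₁ := by
    rw [Real.dist_eq, sub_zero]
    exact hs.trans_lt (half_lt_self hs₁)
  have hp : dist (Literature.Analysis.FunctionSpaces.Torus.proj (s • u)) (0 : T3) < ρ := by
    have := Hs s hds
    rwa [zero_smul, Literature.Analysis.FunctionSpaces.Torus.proj_zero] at this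
  have hxy : dist (x + Literature.Analysis.FunctionSpaces.Torus.proj (s • u)) x < ρ := by
    have h := dist_add_left x (Literature.Analysis.FunctionSpaces.Torus.proj (s • u)) (0 : T3)
    rw [add_zero] at h
    rwa [h]
  have := H hxy
  rw [Real.dist_eq] at this
  exact this.le

/-! ## §3 The window functional along the canonical flow and its boosts -/

section Canonical

variable {σ : ℝ} {N : ℕ}

/-- The window-functional integrand (a sum of one-body terms over the particles): positions tested against `ψ`,
standardised velocities against `g`. -/
def obsSum (ψ : T3 → ℝ) (g : V3 → ℝ) (θ : ℝ) (u₀ : V3) (y : Config (N + 1) (Fin 3) T3) : ℝ :=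
  ∑ i, ψ (y i).1 * g ((Real.sqrt θ)⁻¹ • ((y i).2 - u₀))

/-- `hsDiameter σ N < 1/2` once `σ < 1/2` (the range of Alexander's theorem on the torus). -/
theorem hsDiameter_lt_half {σ : ℝ} (hσ : 0 < σ) (hσ' : σ < 2⁻¹) (N : ℕ) : hsDiameter σ N < 2⁻¹ :=
  (hsDiameter_le hσ.le N).trans_lt hσ'

/-- **Every flow may be replaced by the canonical flow inside the window functional**, under any law absolutely
continuous w.r.t. the Liouville measure and for windows `[0, h]`, `0 ≤ h`: the orbits agree a.e. at all forward times
(`ae_forall_flow_eq_regFlow`). [folklore] -/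
theorem lintegral_window_congr_regFlow (hε : 0 < hsDiameter σ N) (hε' : hsDiameter σ N < 2⁻¹) (Φ : TFlow σ N)
    {P : Measure (Config (N + 1) (Fin 3) T3)}
    (hP : P ≪ liouville (Torus.geometry (Fin 3)) (N + 1) (hsDiameter σ N))
    (H : ℝ → ℝ≥0∞) (F : Config (N + 1) (Fin 3) T3 → ℝ) {h : ℝ} (hh : 0 ≤ h) :
    ∫⁻ z, H (∫ s in (0 : ℝ)..h, F (Φ.flow s z)) ∂P =
      ∫⁻ z, H (∫ s in (0 : ℝ)..h, F (Alexander.regFlow (Torus.geometry (Fin 3)) (hsDiameter σ N) s z)) ∂P := by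
  refine lintegral_congr_ae ?_
  filter_upwards [hP (ae_forall_flow_eq_regFlow hε hε' Φ)] with z hz
  congr 1
  refine intervalIntegral.integral_congr fun s hs => ?_
  rw [uIcc_of_le hh] at hs
  simp only [hz s hs.1]

/-- **The canonical orbit of a velocity-translated datum is the boosted orbit of the boosted canonical flow**
(every datum, every time): `regFlow_s (boostAt u₀ 0 w) = boostAt u₀ s ((boostReg … (−u₀))_s w)`. [folklore] -/
theorem regFlow_boostAt_zero (hε : 0 < hsDiameter σ N) (hε' : hsDiameter σ N < 2⁻¹) (u₀ : V3) (s : ℝ)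
    (w : Config (N + 1) (Fin 3) T3) :
    Alexander.regFlow (Torus.geometry (Fin 3)) (hsDiameter σ N) s (boostAt u₀ 0 w) =
      boostAt u₀ s ((boostReg (d := Fin 3) hε hε' (N + 1) (-u₀)).flow s w) := by
  rw [boostReg_flow, neg_neg, boostAt_boostAt_neg]

/-- The boosted integrand: testing the boosted configuration `boostAt u₀ s y` against `(ψ, g)` in the frame with drift
`u₀` is testing `y` against the DISPLACED test function `x ↦ ψ(x + proj(s u₀))` in the frame with drift `0`. [folklore] -/
theorem obsSum_boostAt (ψ : T3 → ℝ) (g : V3 → ℝ) (θ : ℝ) (u₀ : V3) (s : ℝ) (y : Config (N + 1) (Fin 3) T3) :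
    obsSum ψ g θ u₀ (boostAt u₀ s y) =
      obsSum (fun x => ψ (x + Literature.Analysis.FunctionSpaces.Torus.proj (s • u₀))) g θ 0 y := by
  simp only [obsSum, boostAt_apply, add_sub_cancel_right, sub_zero]

/-- **Measurability in time of the canonical flow at a fixed datum** (a section of the jointly measurable
`Alexander.regFlow`, `measurable_regFlow_uncurry`; `Measurable.comp` is given its two maps explicitly — inferring them by
higher-order unification against `regFlow` is prohibitively slow). [folklore] -/
theorem measurable_regFlow_left (hε' : hsDiameter σ N < 2⁻¹) (y : Config (N + 1) (Fin 3) T3) :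
    Measurable fun s : ℝ => Alexander.regFlow (Torus.geometry (Fin 3)) (hsDiameter σ N) s y := by
  have h : Measurable fun p : ℝ × Config (N + 1) (Fin 3) T3 =>
      Alexander.regFlow (Torus.geometry (Fin 3)) (hsDiameter σ N) p.1 p.2 :=
    Alexander.measurable_regFlow_uncurry hε'
  have h2 : Measurable fun s : ℝ => ((s, y) : ℝ × Config (N + 1) (Fin 3) T3) := measurable_prodMk_right
  exact Measurable.comp (g := fun p : ℝ × Config (N + 1) (Fin 3) T3 =>
    Alexander.regFlow (Torus.geometry (Fin 3)) (hsDiameter σ N) p.1 p.2) (f := fun s : ℝ => (s, y)) h h2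

/-- **Joint measurability of the boosted canonical flow in time**: for every datum `w`, `s ↦ (boostReg … u)_s w` is
measurable (the canonical flow is jointly measurable, `measurable_regFlow_uncurry`; the boost is continuous). [folklore] -/
theorem measurable_boostReg_flow_left (hε : 0 < hsDiameter σ N) (hε' : hsDiameter σ N < 2⁻¹) (u : V3)
    (w : Config (N + 1) (Fin 3) T3) :
    Measurable fun s : ℝ => (boostReg (d := Fin 3) hε hε' (N + 1) u).flow s w := by
  have hR : Measurable fun s : ℝ =>
      Alexander.regFlow (Torus.geometry (Fin 3)) (hsDiameter σ N) s (boostAt (-u) 0 w) :=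
    measurable_regFlow_left hε' _
  have h2 : Measurable fun s : ℝ =>
      boostAt u s (Alexander.regFlow (Torus.geometry (Fin 3)) (hsDiameter σ N) s (boostAt (-u) 0 w)) :=
    Measurable.comp (g := fun p : ℝ × Config (N + 1) (Fin 3) T3 => boostAt u p.1 p.2)
      (f := fun s : ℝ => (s, Alexander.regFlow (Torus.geometry (Fin 3)) (hsDiameter σ N) s (boostAt (-u) 0 w)))
      (continuous_boostAt u).measurable (measurable_id.prodMk hR)
  have hfun : (fun s : ℝ => (boostReg (d := Fin 3) hε hε' (N + 1) u).flow s w) = fun s =>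
      boostAt u s (Alexander.regFlow (Torus.geometry (Fin 3)) (hsDiameter σ N) s (boostAt (-u) 0 w)) :=
    funext fun s => boostReg_flow hε hε' u s w
  rw [hfun]
  exact h2

/-- The one-body sum is jointly continuous in a continuous displacement parameter and the configuration: for
`ψ : ℝ → T3 → ℝ` jointly continuous and `g` continuous, `(s, y) ↦ obsSum (ψ s) g θ u₀ y` is continuous. [folklore] -/
theorem continuous_obsSum_param {ψ : ℝ → T3 → ℝ} (hψ : Continuous (Function.uncurry ψ)) {g : V3 → ℝ}
    (hg : Continuous g) (θ : ℝ) (u₀ : V3) :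
    Continuous fun p : ℝ × Config (N + 1) (Fin 3) T3 => obsSum (ψ p.1) g θ u₀ p.2 := by
  unfold obsSum
  refine continuous_finsetSum _ fun i _ => ?_
  have hi : Continuous fun p : ℝ × Config (N + 1) (Fin 3) T3 => p.2 i := (continuous_apply i).comp continuous_snd
  have hsm : Continuous fun p : ℝ × Config (N + 1) (Fin 3) T3 => (Real.sqrt θ)⁻¹ • ((p.2 i).2 - u₀) :=
    (continuous_const (y := (Real.sqrt θ)⁻¹)).smul (hi.snd.sub continuous_const)
  exact (hψ.comp (continuous_fst.prodMk hi.fst)).mul (hg.comp hsm)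

/-- The one-body sum against a bounded pair `|ψ| ≤ 1`, `|g| ≤ κ` is bounded by `(N + 1) κ`. [folklore] -/
theorem abs_obsSum_le {ψ : T3 → ℝ} {g : V3 → ℝ} {κ : ℝ} (hψ : ∀ x, |ψ x| ≤ 1) (hg : ∀ v, |g v| ≤ κ) (θ : ℝ)
    (u₀ : V3) (y : Config (N + 1) (Fin 3) T3) : |obsSum ψ g θ u₀ y| ≤ (N + 1) * κ := by
  unfold obsSum
  refine (Finset.abs_sum_le_sum_abs _ _).trans ?_
  calc ∑ i : Fin (N + 1), |ψ (y i).1 * g ((Real.sqrt θ)⁻¹ • ((y i).2 - u₀))|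
      ≤ ∑ _i : Fin (N + 1), κ := Finset.sum_le_sum fun i _ => by
        rw [abs_mul]
        exact (mul_le_mul (hψ _) (hg _) (abs_nonneg _) zero_le_one).trans_eq (one_mul κ)
    _ = (N + 1) * κ := by
        simp only [Finset.sum_const, Finset.card_univ, Fintype.card_fin, nsmul_eq_mul, Nat.cast_add, Nat.cast_one]

/-- The displacement error of the one-body sum: `|obsSum ψ' − obsSum ψ| ≤ (N+1) κ η` when `|ψ' − ψ| ≤ η` pointwise and
`|g| ≤ κ`. [folklore] -/
theorem abs_obsSum_sub_le {ψ ψ' : T3 → ℝ} {g : V3 → ℝ} {κ η : ℝ} (hψ : ∀ x, |ψ' x - ψ x| ≤ η) (hg : ∀ v, |g v| ≤ κ)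
    (θ : ℝ) (u₀ : V3) (y : Config (N + 1) (Fin 3) T3) :
    |obsSum ψ' g θ u₀ y - obsSum ψ g θ u₀ y| ≤ (N + 1) * κ * η := by
  unfold obsSum
  rw [← Finset.sum_sub_distrib]
  refine (Finset.abs_sum_le_sum_abs _ _).trans ?_
  have hη : 0 ≤ η := (abs_nonneg _).trans (hψ ((y 0).1))
  calc ∑ i : Fin (N + 1), |ψ' (y i).1 * g ((Real.sqrt θ)⁻¹ • ((y i).2 - u₀)) -
          ψ (y i).1 * g ((Real.sqrt θ)⁻¹ • ((y i).2 - u₀))|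
      ≤ ∑ _i : Fin (N + 1), η * κ := Finset.sum_le_sum fun i _ => by
        rw [← sub_mul, abs_mul]
        exact mul_le_mul (hψ _) (hg _) (abs_nonneg _) hη
    _ = (N + 1) * κ * η := by
        simp only [Finset.sum_const, Finset.card_univ, Fintype.card_fin, nsmul_eq_mul, Nat.cast_add, Nat.cast_one]
        ring

/-- **Freezing the moving test function along a flow whose orbit is measurable in time** (every such datum; e.g.
the boosted canonical flow `boostReg`, `measurable_boostReg_flow_left`). For a window `0 < h ≤ s₀` inside the range where
the displacement `φ(· + proj(s u₀)) − φ` is `≤ η`, and `|φ| ≤ 1`, `|g| ≤ κ`: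
`h⁻¹ ∫₀ʰ obsSum (φ(· + proj(s u₀))) g θ 0 (Ψ_s w) ds ≤ h⁻¹ ∫₀ʰ obsSum φ g θ 0 (Ψ_s w) ds + (N+1) κ η`
(both time integrands are bounded and measurable, hence integrable, so the junk-free comparison applies). [folklore] -/
theorem window_moving_le_static (Ψ : TFlow σ N) {w : Config (N + 1) (Fin 3) T3}
    (hflow : Measurable fun s : ℝ => Ψ.flow s w)
    {φ : T3 → ℝ} {g : V3 → ℝ} (hφc : Continuous φ) (hgc : Continuous g) (hφ : ∀ x, |φ x| ≤ 1) {κ : ℝ}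
    (hg : ∀ v, |g v| ≤ κ) (θ : ℝ) (u₀ : V3) {η s₀ h : ℝ} (hh : 0 < h) (hhs : h ≤ s₀)
    (hη : ∀ s : ℝ, |s| ≤ s₀ → ∀ x : T3,
      |φ (x + Literature.Analysis.FunctionSpaces.Torus.proj (s • u₀)) - φ x| ≤ η) :
    h⁻¹ * (∫ s in (0 : ℝ)..h, obsSum (fun x => φ (x + Literature.Analysis.FunctionSpaces.Torus.proj (s • u₀))) g θ 0
        (Ψ.flow s w)) ≤
      h⁻¹ * (∫ s in (0 : ℝ)..h, obsSum φ g θ 0 (Ψ.flow s w)) + (N + 1) * κ * η := by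
  have hm_meas : Measurable fun s : ℝ =>
      obsSum (fun x => φ (x + Literature.Analysis.FunctionSpaces.Torus.proj (s • u₀))) g θ 0 (Ψ.flow s w) := by
    have hc : Continuous fun p : ℝ × Config (N + 1) (Fin 3) T3 =>
        obsSum (fun x => φ (x + Literature.Analysis.FunctionSpaces.Torus.proj (p.1 • u₀))) g θ 0 p.2 :=
      continuous_obsSum_param (ψ := fun s x => φ (x + Literature.Analysis.FunctionSpaces.Torus.proj (s • u₀)))
        (hφc.comp (continuous_snd.add
          (Literature.Analysis.FunctionSpaces.Torus.continuous_proj.comp (continuous_fst.smul continuous_const))))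
        hgc θ 0
    exact Measurable.comp (g := fun p : ℝ × Config (N + 1) (Fin 3) T3 =>
        obsSum (fun x => φ (x + Literature.Analysis.FunctionSpaces.Torus.proj (p.1 • u₀))) g θ 0 p.2)
      (f := fun s : ℝ => (s, Ψ.flow s w)) hc.measurable (measurable_id.prodMk hflow)
  have hst_meas : Measurable fun s : ℝ => obsSum φ g θ 0 (Ψ.flow s w) := by
    have hc : Continuous fun p : ℝ × Config (N + 1) (Fin 3) T3 => obsSum φ g θ 0 p.2 :=
      continuous_obsSum_param (ψ := fun _ : ℝ => φ) (hφc.comp continuous_snd) hgc θ 0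
    exact Measurable.comp (g := fun p : ℝ × Config (N + 1) (Fin 3) T3 => obsSum φ g θ 0 p.2)
      (f := fun s : ℝ => (s, Ψ.flow s w)) hc.measurable (measurable_id.prodMk hflow)
  have hint : ∀ f : ℝ → ℝ, Measurable f → (∀ s, |f s| ≤ (N + 1) * κ) → IntervalIntegrable f volume 0 h := by
    intro f hf hb
    rw [intervalIntegrable_iff_integrableOn_Ioc_of_le hh.le]
    refine Measure.integrableOn_of_bounded (M := (N + 1) * κ) measure_Ioc_lt_top.ne hf.aestronglyMeasurable ?_
    exact Eventually.of_forall fun s => by rw [Real.norm_eq_abs]; exact hb s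
  have hmi := hint _ hm_meas fun s =>
    abs_obsSum_le (ψ := fun x => φ (x + Literature.Analysis.FunctionSpaces.Torus.proj (s • u₀))) (fun x => hφ _) hg θ 0 _
  have hsti := hint _ hst_meas fun s => abs_obsSum_le hφ hg θ 0 _
  -- pointwise comparison on the window
  have hle : ∀ s ∈ Icc (0 : ℝ) h,
      obsSum (fun x => φ (x + Literature.Analysis.FunctionSpaces.Torus.proj (s • u₀))) g θ 0 (Ψ.flow s w) ≤
        obsSum φ g θ 0 (Ψ.flow s w) + (N + 1) * κ * η := by
    intro s hs
    have hsabs : |s| ≤ s₀ := by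
      rw [abs_of_nonneg hs.1]
      exact hs.2.trans hhs
    have h1 := abs_obsSum_sub_le (ψ := φ)
      (ψ' := fun x => φ (x + Literature.Analysis.FunctionSpaces.Torus.proj (s • u₀))) (g := g) (hη s hsabs) hg θ 0
      (Ψ.flow s w)
    have h2 := (le_abs_self _).trans h1
    linarith
  have hI := intervalIntegral.integral_mono_on hh.le hmi (hsti.add intervalIntegrable_const) hle
  rw [intervalIntegral.integral_add hsti intervalIntegrable_const, intervalIntegral.integral_const, sub_zero,
    smul_eq_mul] at hI
  have hh' : 0 < h⁻¹ := inv_pos.2 hh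
  calc h⁻¹ * (∫ s in (0 : ℝ)..h,
          obsSum (fun x => φ (x + Literature.Analysis.FunctionSpaces.Torus.proj (s • u₀))) g θ 0 (Ψ.flow s w))
      ≤ h⁻¹ * ((∫ s in (0 : ℝ)..h, obsSum φ g θ 0 (Ψ.flow s w)) + h * ((N + 1) * κ * η)) :=
        mul_le_mul_of_nonneg_left hI hh'.le
    _ = h⁻¹ * (∫ s in (0 : ℝ)..h, obsSum φ g θ 0 (Ψ.flow s w)) + (N + 1) * κ * η := by
        rw [mul_add, ← mul_assoc h⁻¹ h, inv_mul_cancel₀ hh.ne', one_mul]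

end Canonical

/-! ## §3b The registered helper statement of this file -/

/-- **WINDOW FREEZING (registered helper stub `stub_windowFreezing`).** Along any hard-sphere flow on `𝕋³` whose orbit from
the datum `w` is measurable in time, for a continuous bounded pair `|φ| ≤ 1`, `|g| ≤ κ`, a drift `u₀`, a displacement
tolerance `η` valid for `|s| ≤ s₀` and a window `0 < h ≤ s₀`: the window average of the one-body sum with the MOVING test
function `φ(· + proj(s u₀))` exceeds the one with the frozen `φ` by at most `(N+1) κ η`. -/
def WindowFreezing : Prop :=
  ∀ (σ : ℝ) (N : ℕ) (Ψ : TFlow σ N) (w : Config (N + 1) (Fin 3) T3), (Measurable fun s : ℝ => Ψ.flow s w) →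
    ∀ (φ : T3 → ℝ) (g : V3 → ℝ), Continuous φ → Continuous g → (∀ x, |φ x| ≤ 1) → ∀ κ : ℝ, (∀ v, |g v| ≤ κ) →
    ∀ (θ : ℝ) (u₀ : V3) (η s₀ h : ℝ), 0 < h → h ≤ s₀ →
    (∀ s : ℝ, |s| ≤ s₀ → ∀ x : T3, |φ (x + Literature.Analysis.FunctionSpaces.Torus.proj (s • u₀)) - φ x| ≤ η) →
    h⁻¹ * (∫ s in (0 : ℝ)..h, obsSum (fun x => φ (x + Literature.Analysis.FunctionSpaces.Torus.proj (s • u₀))) g θ 0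
        (Ψ.flow s w)) ≤
      h⁻¹ * (∫ s in (0 : ℝ)..h, obsSum φ g θ 0 (Ψ.flow s w)) + (N + 1) * κ * η

/-- **Proved**: `stub_windowFreezing` (`window_moving_le_static`). [folklore] -/
theorem stub_windowFreezing : WindowFreezing :=
  fun _ _ Ψ _ hflow _ _ hφc hgc hφ _ hg θ u₀ _ _ _ hh hhs hη =>
    window_moving_le_static Ψ hflow hφc hgc hφ hg θ u₀ hh hhs hη

end Summit.AtomisticToContinuum.HydrodynamicLimit.Theorems.KineticWindowGronwallFrame

end
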